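import Summits.QuantumFields.BalabanUV.Beta.FP.CompositeStencilTables

/-!
# `BalabanUV.Beta.FP.CompositeJetData` — road «FP» for binder row D1 (R-FP-50 (a), Q-JC-1): **`JcOf` — THE COMPOSITE JET DATA OF RECORD AS A TYPED FAMILY
# `∀ m, JetData d (Lc^m)`**, its `m ≥ 1` members being EXACTLY the composite objects `SfoldComp … m` ∕ `WtComp … m` of `FP/CompositeStencilTables` (the objects
# leaf-06's END `RoadLeftLiteralSfoldComp.d1Drift_JsB12Sym_of_sliceLedger_ghost_SfoldComp` instantiates), with constants and a common rate CHOSEN from the landed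
# letters `locStencil_SfoldComp` ∕ `vertexFamily₂_WtComp`; the `m = 0` member is ZERO PADDING (no road reads it)

HONEST DEPENDENCY (page 1, mandatory): continuum YM on T⁴ ⇐ BetaPertH ∧ nine spine estimates (0/9 proved); BetaPertH ⇐ (D1) ∧ (D4) ∧ CAP+tail;
G-an2-4 gates asym, D1 and NE2/3/4.  HONEST FRAMING (cell contract, verbatim): «discharging `BetaPertH` makes Bałaban's UV stability UNCONDITIONAL —
a real constructive-QFT result; it is NOT the continuum limit and NOT the Clay problem.»  ABSOLUTE RULE (cell charter, verbatim): «No internally-minted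
statement may enter as a cited fact. Every hypothesis is either kernel-proved in this package or a verbatim quotation of a PUBLISHED theorem with page
reference. The manuscript(s) under audit are NOT citable for their own disputed steps — they are the thing under adjudication; programme-internal
(2001/route/tribunal) claims are never citable.»  THIS MODULE DEFINES OUR OBJECTS (data, asserting nothing; «not in print») over landed objects and
`Classical.choose` of landed letters: `zeroJet`, `JcOfSucc`, `JcOf`; the letters proved are the two ∃-packagings at the record and unfoldings.  0 `def … : Prop`,
nothing cited, 0 sorry; 0∕4 row-D1 binders; NOT `D1Tel`, NOT the BF-x `hptw` dictionary, NOT SDF, NOT D1, NOT BetaPertH, NOT continuum, NOT Clay.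
DEFINITION lane (reviewed).

WHY (an2 g35 R-D1-g35-4 (Q-JC-1) l.37030: «`def JcOf … : ∀ m, JetData 3 (Lc^m)` in an `FP/` defs file … both roads type against THAT name»; OWNER d1-p3 g17
LANDED-3 l.37134: NAMED `FP/CompositeJetData`, `S := SfoldComp Lc (qSym Lc) lamPerfect tabs.V Spure cVHc SLam m`, `W := WtComp Lc (qSym Lc) lamPerfect Spure cVHc ε₂
Gc tabs cΛ S₂inf cBc m`, constants ∕ rate by `Classical.choose` over leaf-02's letters, `m = 0` padded — «TYPING: first refusal leaf-02»; W-FP-17-2 (5): TABLE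
PARAMETERS displayed so the (III′) literal swaps `tabs` and the def is written ONCE).
SHAPE.  Parameters: `tabs : SymTables d Lc`; the m = 1 pure stencil `Spure` with ONE locality letter `hSp : LocStencil Spure Cs δsp`, `0 < δsp`; `cVHc : ℕ → ℝ`;
the fold family `SLam : ℕ → …` with `hL : ∀ m, 1 ≤ m → LocStencil (SLam m) (CL m) (δL m)`, `hδL` (the m = 1 fold letter IS needed for a total family whose
m = 1 member is `SfoldComp … 1 = Spure + SLam 1`); `ε₂`, the K-slot family `Gc` with `hGc : ∀ m, 1 ≤ m → ∃ δ₀ C, 0 < δ₀ ∧ 0 ≤ C ∧ Decays (Gc m) C δ₀`, `cΛ`,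
`S₂inf` with `hS₂ : LocStencil₂ S₂inf C₂ δ₂`, `0 < δ₂`, `cBc`.  Members: `JcOf … (m+1) = JcOfSucc … m` with `.S = SfoldComp … (m+1)`, `.W = WtComp … (m+1)` (`rfl`);
`JcOf … 0 = zeroJet d (Lc^0)`.  At `d = 3` this is the `Jc : ∀ m, JetData 3 (Lc^m)` binder of road BF-x's END and of road FP's `D1Tel` transport.
Provenance: D1 formalisation swarm LEAF PROVER 02, unit b2b-balaban-beta-d1-formalise-leaf-02 gen 16, 2026-08-21 (INTENT I-d1leaf02g16-5).  No existing file touched. -/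

noncomputable section

namespace Summit.QuantumFields.BalabanUV.Beta.FP.CompositeJetData

open Literature.MathematicalPhysics.QuantumFieldTheory.Balaban1983to89
open Literature.MathematicalPhysics.QuantumFieldTheory.Balaban1983to89.Beta
open B12Sec2to5 (l1 l1_nonneg)
open ExpKernelCalculus (MKer Decays BiLoc VertexFamily₂)
open AffineAveraging (Site)
open OneStepResolventKernel (Fib LocStencil JetData biLoc_mono)
open BalabanStepJets (locStencil_mono)
open BalabanCompositeJets (LocStencil₂)
open Summit.QuantumFields.BalabanUV.Beta.SymmetrisedStepJets (SymTables)
open Summit.QuantumFields.BalabanUV.Beta.FP.PerfectSecondOrderTablesInf (qSym lamPerfect)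
open Summit.QuantumFields.BalabanUV.Beta.FP.CompositeStencilTables (SfoldComp WtComp locStencil_SfoldComp vertexFamily₂_WtComp qSym_decays)

variable {d : ℕ}

/-! ## §1 Plumbing: a second-order locality letter survives a smaller rate; the zero datum -/

/-- [folklore] A local bi-stencil family stays local at any smaller rate (constant nonnegative): both the bond-separation factor and the bi-localisation
weaken monotonically. -/
theorem locStencil₂_mono {S₂ : Fin (d + 1) → Site (d + 1) → Fin (d + 1) → Site (d + 1) → MKer (d + 1) (Fib d)} {C δ δ' : ℝ}
    (h : LocStencil₂ S₂ C δ) (hC : 0 ≤ C) (hle : δ' ≤ δ) : LocStencil₂ S₂ C δ' := by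
  intro κ u κ' u'
  have h1 : BiLoc (S₂ κ u κ' u') u u (C * Real.exp (-δ' * l1 (u' - u))) δ := fun x y a b => by
    refine (h κ u κ' u' x y a b).trans (mul_le_mul_of_nonneg_right ?_ (Real.exp_pos _).le)
    exact mul_le_mul_of_nonneg_left (Real.exp_le_exp.2 (by nlinarith [l1_nonneg (u' - u)])) hC
  exact biLoc_mono h1 (by positivity) hle

/-- [our object — padding] **THE ZERO JET DATUM** at any blocking: `S = 0`, `W = 0`, constants `0`, rate `1`. -/
def zeroJet (d N : ℕ) : JetData d N where
  S := 0
  W := 0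
  Cs := 0
  Cw := 0
  δ := 1
  δ_pos := one_pos
  loc := fun κ u x y a b => by simp
  loc₂ := fun μ y ν y' x z a b => by simp

/-- [folklore] the zero datum's tables. -/
@[simp] theorem zeroJet_S (d N : ℕ) : (zeroJet d N).S = 0 := rfl

/-- [folklore] … -/
@[simp] theorem zeroJet_W (d N : ℕ) : (zeroJet d N).W = 0 := rfl

/-! ## §2 The two letters of the composite members at the record, ∃-packaged -/

section Letters

variable {Lc : ℕ} [NeZero Lc] (tabs : SymTables d Lc)
  (Spure : Fin (d + 1) → Site (d + 1) → MKer (d + 1) (Fib d)) {Cs δsp : ℝ} (hSp : LocStencil Spure Cs δsp) (hδsp : 0 < δsp) (cVHc : ℕ → ℝ)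
  (SLam : ℕ → Fin (d + 1) → Site (d + 1) → MKer (d + 1) (Fib d)) {CL δL : ℕ → ℝ}
  (hL : ∀ m, 1 ≤ m → LocStencil (SLam m) (CL m) (δL m)) (hδL : ∀ m, 1 ≤ m → 0 < δL m)
  (ε₂ : ℝ) (Gc : ℕ → MKer (d + 1) (Fib d)) (hGc : ∀ m, 1 ≤ m → ∃ δ₀ C : ℝ, 0 < δ₀ ∧ 0 ≤ C ∧ Decays (Gc m) C δ₀) (cΛ : ℝ)
  (S₂inf : Fin (d + 1) → Site (d + 1) → Fin (d + 1) → Site (d + 1) → MKer (d + 1) (Fib d)) {C₂ δ₂ : ℝ} (hS₂ : LocStencil₂ S₂inf C₂ δ₂) (hδ₂ : 0 < δ₂)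
  (cBc : ℕ → ℝ)

include hSp hδsp hL hδL in
/-- [our object — bookkeeping] **THE COMPOSITE FIRST-ORDER SLOT OF RECORD IS A LOCAL STENCIL FAMILY** (`m+1 ≥ 1`): `locStencil_SfoldComp` at the record inputs
(`qSym_decays`, `tabs.hV` at the rate of `Spure`'s letter; the fold letter at `m+1`). -/
theorem exists_locStencil_SfoldComp_record (m : ℕ) :
    ∃ C δ' : ℝ, 0 < δ' ∧ LocStencil (SfoldComp Lc (qSym Lc) lamPerfect tabs.V Spure cVHc SLam (m + 1)) C δ' := by
  obtain ⟨Cq, hCq, hq⟩ := qSym_decays (d := d) (Lc := Lc) δsp hδsp.le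
  obtain ⟨CV, hV⟩ := tabs.hV δsp hδsp.le
  exact locStencil_SfoldComp hq hCq hδsp hV hSp lamPerfect cVHc (Nat.succ_le_succ (Nat.zero_le m)) (hL (m + 1) (Nat.succ_le_succ (Nat.zero_le m)))
    (hδL (m + 1) (Nat.succ_le_succ (Nat.zero_le m)))

include hSp hδsp hGc hS₂ hδ₂ in
/-- [our object — bookkeeping] **THE COMPOSITE SECOND-ORDER CARRIER OF RECORD IS A VERTEX FAMILY AT BLOCKING `Lc^(m+1)`**: `vertexFamily₂_WtComp` at the record inputs,
all locality letters lowered to the COMMON input rate `min δB (min δsp δ₂)` (`δB` = the record's `tabs.hB` rate). -/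
theorem exists_vertexFamily₂_WtComp_record (m : ℕ) :
    ∃ Cw δw : ℝ, 0 < δw ∧ VertexFamily₂ (WtComp Lc (qSym Lc) lamPerfect Spure cVHc ε₂ Gc tabs cΛ S₂inf cBc (m + 1)) (Lc ^ (m + 1)) Cw δw := by
  obtain ⟨CB, δB, hδB, hB⟩ := tabs.hB
  set δ₀ : ℝ := min δB (min δsp δ₂) with hδ₀def
  have hδ₀ : 0 < δ₀ := lt_min hδB (lt_min hδsp hδ₂)
  obtain ⟨Cq, hCq, hq⟩ := qSym_decays (d := d) (Lc := Lc) δ₀ hδ₀.le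
  obtain ⟨CV, hV⟩ := tabs.hV δ₀ hδ₀.le
  have hCs : 0 ≤ Cs := (hSp 0 0).nonneg (Sum.inl 0)
  have hCB0 := (hB 0 0 0 0).nonneg (Sum.inl 0)
  have hCB : 0 ≤ CB := (mul_nonneg_iff_of_pos_right (Real.exp_pos _)).1 hCB0
  have hC₂0 := (hS₂ 0 0 0 0).nonneg (Sum.inl 0)
  have hC₂ : 0 ≤ C₂ := (mul_nonneg_iff_of_pos_right (Real.exp_pos _)).1 hC₂0
  have hB' : LocStencil₂ tabs.vh₂S CB δ₀ := locStencil₂_mono hB hCB (min_le_left _ _)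
  have hSp' : LocStencil Spure Cs δ₀ := locStencil_mono hSp hCs ((min_le_right _ _).trans (min_le_left _ _))
  have hS₂' : LocStencil₂ S₂inf C₂ δ₀ := locStencil₂_mono hS₂ hC₂ ((min_le_right _ _).trans (min_le_right _ _))
  exact vertexFamily₂_WtComp tabs cΛ ε₂ hq hCq hδ₀ hV hB' hSp' hS₂' lamPerfect cVHc cBc m (hGc (m + 1) (Nat.succ_le_succ (Nat.zero_le m)))

end Letters

/-! ## §3 `JcOfSucc`, `JcOf` -/

section Data

variable {Lc : ℕ} [NeZero Lc] (tabs : SymTables d Lc)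
  (Spure : Fin (d + 1) → Site (d + 1) → MKer (d + 1) (Fib d)) {Cs δsp : ℝ} (hSp : LocStencil Spure Cs δsp) (hδsp : 0 < δsp) (cVHc : ℕ → ℝ)
  (SLam : ℕ → Fin (d + 1) → Site (d + 1) → MKer (d + 1) (Fib d)) {CL δL : ℕ → ℝ}
  (hL : ∀ m, 1 ≤ m → LocStencil (SLam m) (CL m) (δL m)) (hδL : ∀ m, 1 ≤ m → 0 < δL m)
  (ε₂ : ℝ) (Gc : ℕ → MKer (d + 1) (Fib d)) (hGc : ∀ m, 1 ≤ m → ∃ δ₀ C : ℝ, 0 < δ₀ ∧ 0 ≤ C ∧ Decays (Gc m) C δ₀) (cΛ : ℝ)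
  (S₂inf : Fin (d + 1) → Site (d + 1) → Fin (d + 1) → Site (d + 1) → MKer (d + 1) (Fib d)) {C₂ δ₂ : ℝ} (hS₂ : LocStencil₂ S₂inf C₂ δ₂) (hδ₂ : 0 < δ₂)
  (cBc : ℕ → ℝ)

/-- [our object — a CANDIDATE asserting nothing] **THE COMPOSITE JET DATUM OF RECORD AT STEP `m+1`** (blocking `Lc^(m+1)`): `S := SfoldComp … (m+1)`, `W := WtComp … (m+1)`,
constants CHOSEN from the two record letters, rate = the minimum of the two chosen rates. -/
def JcOfSucc (m : ℕ) : JetData d (Lc ^ (m + 1)) where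
  S := SfoldComp Lc (qSym Lc) lamPerfect tabs.V Spure cVHc SLam (m + 1)
  W := WtComp Lc (qSym Lc) lamPerfect Spure cVHc ε₂ Gc tabs cΛ S₂inf cBc (m + 1)
  Cs := (exists_locStencil_SfoldComp_record tabs Spure hSp hδsp cVHc SLam hL hδL m).choose
  Cw := (exists_vertexFamily₂_WtComp_record tabs Spure hSp hδsp cVHc ε₂ Gc hGc cΛ S₂inf hS₂ hδ₂ cBc m).choose
  δ := min (exists_locStencil_SfoldComp_record tabs Spure hSp hδsp cVHc SLam hL hδL m).choose_spec.choose
    (exists_vertexFamily₂_WtComp_record tabs Spure hSp hδsp cVHc ε₂ Gc hGc cΛ S₂inf hS₂ hδ₂ cBc m).choose_spec.choose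
  δ_pos := lt_min (exists_locStencil_SfoldComp_record tabs Spure hSp hδsp cVHc SLam hL hδL m).choose_spec.choose_spec.1
    (exists_vertexFamily₂_WtComp_record tabs Spure hSp hδsp cVHc ε₂ Gc hGc cΛ S₂inf hS₂ hδ₂ cBc m).choose_spec.choose_spec.1
  loc := by
    have h := (exists_locStencil_SfoldComp_record tabs Spure hSp hδsp cVHc SLam hL hδL m).choose_spec.choose_spec.2
    exact locStencil_mono h ((h 0 0).nonneg (Sum.inl 0)) (min_le_left _ _)
  loc₂ := by
    have h := (exists_vertexFamily₂_WtComp_record tabs Spure hSp hδsp cVHc ε₂ Gc hGc cΛ S₂inf hS₂ hδ₂ cBc m).choose_spec.choose_spec.2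
    exact fun μ y ν y' => biLoc_mono (h μ y ν y') ((h μ y ν y').nonneg (Sum.inl 0)) (min_le_right _ _)

/-- [our object — a CANDIDATE asserting nothing] **`JcOf` — THE COMPOSITE JET DATA OF RECORD, ALL STEPS**: `JcOf (m+1) := JcOfSucc m`; `JcOf 0 :=` the ZERO datum (PADDING —
no road reads the `m = 0` member; documented here and in the module docstring). -/
def JcOf : ∀ m : ℕ, JetData d (Lc ^ m)
  | 0 => zeroJet d (Lc ^ 0)
  | m + 1 => JcOfSucc tabs Spure hSp hδsp cVHc SLam hL hδL ε₂ Gc hGc cΛ S₂inf hS₂ hδ₂ cBc m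

/-- [folklore] `JcOf (m+1) = JcOfSucc m`. -/
theorem JcOf_succ (m : ℕ) : JcOf tabs Spure hSp hδsp cVHc SLam hL hδL ε₂ Gc hGc cΛ S₂inf hS₂ hδ₂ cBc (m + 1)
    = JcOfSucc tabs Spure hSp hδsp cVHc SLam hL hδL ε₂ Gc hGc cΛ S₂inf hS₂ hδ₂ cBc m := rfl

/-- [folklore] **THE FIRST-ORDER SLOT OF `JcOf (m+1)` IS `SfoldComp … (m+1)`** (`rfl`). -/
theorem JcOf_S_succ (m : ℕ) : (JcOf tabs Spure hSp hδsp cVHc SLam hL hδL ε₂ Gc hGc cΛ S₂inf hS₂ hδ₂ cBc (m + 1)).S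
    = SfoldComp Lc (qSym Lc) lamPerfect tabs.V Spure cVHc SLam (m + 1) := rfl

/-- [folklore] **THE SECOND-ORDER SLOT OF `JcOf (m+1)` IS `WtComp … (m+1)`** (`rfl`). -/
theorem JcOf_W_succ (m : ℕ) : (JcOf tabs Spure hSp hδsp cVHc SLam hL hδL ε₂ Gc hGc cΛ S₂inf hS₂ hδ₂ cBc (m + 1)).W
    = WtComp Lc (qSym Lc) lamPerfect Spure cVHc ε₂ Gc tabs cΛ S₂inf cBc (m + 1) := rfl

/-- [folklore] the same for every `m ≥ 1` (the predecessor form). -/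
theorem JcOf_S_of_one_le {m : ℕ} (hm : 1 ≤ m) : (JcOf tabs Spure hSp hδsp cVHc SLam hL hδL ε₂ Gc hGc cΛ S₂inf hS₂ hδ₂ cBc m).S
    = SfoldComp Lc (qSym Lc) lamPerfect tabs.V Spure cVHc SLam m := by
  obtain ⟨m', rfl⟩ : ∃ m', m = m' + 1 := ⟨m - 1, by omega⟩
  rfl

/-- [folklore] … -/
theorem JcOf_W_of_one_le {m : ℕ} (hm : 1 ≤ m) : (JcOf tabs Spure hSp hδsp cVHc SLam hL hδL ε₂ Gc hGc cΛ S₂inf hS₂ hδ₂ cBc m).W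
    = WtComp Lc (qSym Lc) lamPerfect Spure cVHc ε₂ Gc tabs cΛ S₂inf cBc m := by
  obtain ⟨m', rfl⟩ : ∃ m', m = m' + 1 := ⟨m - 1, by omega⟩
  rfl

/-- [folklore] the padding member: `(JcOf 0).S = 0`. -/
theorem JcOf_zero_S : (JcOf tabs Spure hSp hδsp cVHc SLam hL hδL ε₂ Gc hGc cΛ S₂inf hS₂ hδ₂ cBc 0).S = 0 := rfl

/-- [folklore] … `(JcOf 0).W = 0`. -/
theorem JcOf_zero_W : (JcOf tabs Spure hSp hδsp cVHc SLam hL hδL ε₂ Gc hGc cΛ S₂inf hS₂ hδ₂ cBc 0).W = 0 := rfl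

/-- [folklore] **THE `TOf` READING** (W-FP-17-3 (ii)): the typed kernel of `JcOf (m+1)` is the resolvent Hessian kernel of the typed `U = 1` system at blocking
`Lc^(m+1)` with the chain-rule vertex of `SfoldComp … (m+1)` and the carrier `WtComp … (m+1)` (`rfl`). -/
theorem TOf_JcOf_succ (m : ℕ) : OneStepResolventKernel.TOf (N := Lc ^ (m + 1)) (JcOf tabs Spure hSp hδsp cVHc SLam hL hδL ε₂ Gc hGc cΛ S₂inf hS₂ hδ₂ cBc (m + 1))
    = ExpKernelCalculus.hessKer (OneStepResolventKernel.KInv (N := Lc ^ (m + 1)) (d := d))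
        (OneStepResolventKernel.vertexOf (N := Lc ^ (m + 1)) (SfoldComp Lc (qSym Lc) lamPerfect tabs.V Spure cVHc SLam (m + 1)))
        (WtComp Lc (qSym Lc) lamPerfect Spure cVHc ε₂ Gc tabs cΛ S₂inf cBc (m + 1)) := rfl

/-- [folklore] the rate of every member is positive (structure field, restated for the typer). -/
theorem JcOf_δ_pos (m : ℕ) : 0 < (JcOf tabs Spure hSp hδsp cVHc SLam hL hδL ε₂ Gc hGc cΛ S₂inf hS₂ hδ₂ cBc m).δ :=
  (JcOf tabs Spure hSp hδsp cVHc SLam hL hδL ε₂ Gc hGc cΛ S₂inf hS₂ hδ₂ cBc m).δ_pos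

end Data

end Summit.QuantumFields.BalabanUV.Beta.FP.CompositeJetData

end
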